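import Summits.KontsevichZagierPeriods.KontsevichZagierPeriods.Theorems.UnfoldedStokesStokesGenerationStubParamLandenPartOne
import Summits.KontsevichZagierPeriods.KontsevichZagierPeriods.Theorems.UnfoldedStokesStokesGenerationStubParamLandenPartTwo
import Summits.KontsevichZagierPeriods.KontsevichZagierPeriods.Theorems.UnfoldedStokesStokesGenerationStubParamLandenPartThree
import Summits.KontsevichZagierPeriods.KontsevichZagierPeriods.Theorems.UnfoldedStokesStokesGenerationStubParamLandenLeftovers
import Summits.KontsevichZagierPeriods.KontsevichZagierPeriods.Theorems.UnfoldedStokesStokesGenerationFibrewiseRungLanden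
import Summits.KontsevichZagierPeriods.KontsevichZagierPeriods.Theorems.UnfoldedStokesStokesGenerationFibrewiseClosureSum
import Summits.KontsevichZagierPeriods.KontsevichZagierPeriods.Theorems.UnfoldedStokesStokesGenerationFibrewiseRungAngSwap

/-!
# `StokesGeneration` (stmt-KontsevichZagierPeriods-3586), line `fibrewise_stokes` — rung 25: Landen's identity with a parameter

Crux `Summit.KontsevichZagierPeriods.KontsevichZagierPeriods.Theses.UnfoldedStokes.StokesGeneration`; residual stub S2
(`FibStokesDecomposable`, `Theorems/UnfoldedStokesDefs.lean`). Rung 18 proved that Landen's integrand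
`Λ_a(s,t) = a/(1−ast) − a/(1−a+ast) + ½a²/((1−as)(1−at))` (value `Li₂(a) + Li₂(−a/(1−a)) + ½log²(1−a) = 0`) is fibrewise-Stokes
decomposable at every fixed real algebraic `a < 1`. Its certificate (the homotopy `a ↦ au` in a further cube coordinate, two
closed-form RATIONAL elements per term, soft leftovers) is uniform in `a`; run with a SILENT coordinate `v` it proves that the
whole FAMILY `γ(v)·Λ_{a(v)}(s,t)` is decomposable on `[0,1]³` for `a, γ` `ℚ`-semialgebraic and `C¹` near `[0,1]` with `a < 1`
(`fibStokesDecomposable_paramLanden`; stubs `stub_paramLandenPartOne/Two/Three`, `stub_paramLandenLeftovers`). This is the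
device by which the `v`-derivative of a weight-three functional equation is fed back into weight two (rung 26, the
trilogarithm): the induction on the weight.

References: D. Zagier, *The dilogarithm function* (2007), §I.2; M. Kontsevich, D. Zagier, *Periods* (2001), §1.2.
-/

noncomputable section

-- `Summit.KontsevichZagierPeriods.KontsevichZagierPeriods.…` is the tree's mandated layout (single-conjunct summit).
set_option linter.dupNamespace false

namespace Summit.KontsevichZagierPeriods.KontsevichZagierPeriods.Cruxes.StokesGeneration.FibrewiseStokes

open MeasureTheory Set
open Literature.NumberTheory.Transcendental
open Literature.NumberTheory.Transcendental.KZ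
open Literature.ModelTheory.ExponentialFields (IsSemialgebraic)

/-- **Rung 25 (lead c6): Landen's identity with a parameter.** For `a, γ` `ℚ`-semialgebraic and `C¹` on an open interval
around `[0,1]` with `a < 1` there, the family `γ(v)·Λ_{a(v)}(s,t)` of Landen integrands
(`Λ_a(s,t) = a/(1−ast) − a/(1−a+ast) + ½a²/((1−as)(1−at))`, of value `Li₂(a) + Li₂(−a/(1−a)) + ½log²(1−a) = 0` for every
`a < 1`) is fibrewise-Stokes decomposable on `[0,1]³` (`s = x 0`, `t = x 1`, `v = x 2`): rung 18's certificate (the homotopy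
`a ↦ au` in a fourth coordinate `u`, closed-form rational elements along `u`, `t`, `s`, soft leftovers) is uniform in `a`,
so it runs with `v` SILENT (`stub_paramLandenPartOne/Two/Three`, `stub_paramLandenLeftovers` on `[0,1]⁴` with `u = x 2`,
`v = x 3`); subtract, identify pointwise, swap the coordinates `2 ↔ 3` (`fibStokesDecomposable_perm`) and un-pad. The tool by
which the `v`-derivative of a weight-three functional equation is fed back into weight two (rung 26).
[cite: Zagier2007Dilogarithm, §I.2] -/
theorem fibStokesDecomposable_paramLanden (a γ : ℝ → ℝ) (δ : ℝ) (hδ : 0 < δ)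
    (ha : IsSemialgebraicFunOn ℚ {z : Fin 1 → ℝ | z 0 ∈ Set.Ioo (-δ) (1 + δ)} (fun z => a (z 0)))
    (hγ : IsSemialgebraicFunOn ℚ {z : Fin 1 → ℝ | z 0 ∈ Set.Ioo (-δ) (1 + δ)} (fun z => γ (z 0)))
    (hac : ContDiffOn ℝ 1 a (Set.Ioo (-δ) (1 + δ))) (hγc : ContDiffOn ℝ 1 γ (Set.Ioo (-δ) (1 + δ)))
    (ha1 : ∀ v ∈ Set.Ioo (-δ) (1 + δ), a v < 1) :
    FibStokesDecomposable 3 (fun x => γ (x 2) * (a (x 2) / (1 - a (x 2) * x 0 * x 1) -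
      a (x 2) / (1 - a (x 2) + a (x 2) * x 0 * x 1) +
      (1 / 2) * ((-a (x 2) / (1 - a (x 2) * x 0)) * (-a (x 2) / (1 - a (x 2) * x 1))))) := by
  have h1 := stub_paramLandenPartOne a γ δ hδ ha hγ hac hγc ha1
  have h2 := stub_paramLandenPartTwo a γ δ hδ ha hγ hac hγc ha1
  have h3 := stub_paramLandenPartThree a γ δ hδ ha hγ hac hγc ha1
  have h4 := stub_paramLandenLeftovers a γ δ hδ ha hγ hac hγc ha1
  have h123 := fibStokesDecomposable_add 4 _ _ (fibStokesDecomposable_add 4 _ _ h1 h2) h3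
  have hdiff := fibStokesDecomposable_sub 4 _ _ h4 h123
  -- swap the silent parameter `v = x 3` with the homotopy variable `u = x 2`, then un-pad to `[0,1]³`
  have hperm := fibStokesDecomposable_perm 4 (Equiv.swap (2 : Fin 4) 3) _ hdiff
  have hle : 3 ≤ 4 := by norm_num
  refine fibStokesDecomposable_unpad hle _ (fibStokesDecomposable_congr_off_null 4 _ _ ∅
    Literature.ModelTheory.ExponentialFields.isSemialgebraic_empty measure_empty (fun x hx _ => ?_) hperm)
  have hm : ∀ i, x i ∈ Set.Icc (0:ℝ) 1 := fun i => (Set.mem_univ_pi.mp hx) i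
  have e0 : x (Fin.castLE hle 0) = x 0 := rfl
  have e1 : x (Fin.castLE hle 1) = x 1 := rfl
  have e2 : x (Fin.castLE hle 2) = x 2 := rfl
  have s0 : (Equiv.swap (2 : Fin 4) 3) 0 = 0 := by decide
  have s1 : (Equiv.swap (2 : Fin 4) 3) 1 = 1 := by decide
  have s2 : (Equiv.swap (2 : Fin 4) 3) 2 = 3 := by decide
  have s3 : (Equiv.swap (2 : Fin 4) 3) 3 = 2 := by decide
  simp only [e0, e1, e2, s0, s1, s2, s3]
  -- positivity of all denominators at the parameter value `a (x 2) < 1`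
  have h0 := hm 0; have h1' := hm 1; have h2' := hm 2; have h3' := hm 3
  simp only [Set.mem_Icc] at h0 h1' h2' h3'
  have hav : a (x 2) < 1 := ha1 _ ⟨by linarith [h2'.1], by linarith [h2'.2]⟩
  set A : ℝ := a (x 2) with hA
  have hmul : ∀ {p q : ℝ}, 0 ≤ p → p ≤ 1 → 0 ≤ q → q ≤ 1 → 0 ≤ p * q ∧ p * q ≤ 1 :=
    fun hp0 hp1 hq0 hq1 => ⟨mul_nonneg hp0 hq0, by nlinarith⟩
  have d30 : 0 < 1 - A * x 3 * x 0 := by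
    have := hmul h3'.1 h3'.2 h0.1 h0.2; rw [mul_assoc]; exact landen_denom_pos hav this.1 this.2
  have d31 : 0 < 1 - A * x 3 * x 1 := by
    have := hmul h3'.1 h3'.2 h1'.1 h1'.2; rw [mul_assoc]; exact landen_denom_pos hav this.1 this.2
  have d01 : 0 < 1 - A * x 0 * x 1 := by
    have := hmul h0.1 h0.2 h1'.1 h1'.2; rw [mul_assoc]; exact landen_denom_pos hav this.1 this.2
  have d3 : 0 < 1 - A * x 3 := landen_denom_pos hav h3'.1 h3'.2
  have d0 : 0 < 1 - A * x 0 := landen_denom_pos hav h0.1 h0.2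
  have d1 : 0 < 1 - A * x 1 := landen_denom_pos hav h1'.1 h1'.2
  have d3r : 0 < 1 - A * x 3 + A * x 3 * x 0 := by
    have hq : 0 ≤ x 3 * (1 - x 0) ∧ x 3 * (1 - x 0) ≤ 1 := hmul h3'.1 h3'.2 (by linarith) (by linarith)
    have := landen_denom_pos hav hq.1 hq.2; nlinarith
  have dr : 0 < 1 - A + A * x 0 * x 1 := by
    have hq : 0 ≤ 1 - x 0 * x 1 ∧ 1 - x 0 * x 1 ≤ 1 := by
      have := hmul h0.1 h0.2 h1'.1 h1'.2; exact ⟨by linarith, by linarith⟩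
    have := landen_denom_pos hav hq.1 hq.2; nlinarith
  field_simp
  ring

end Summit.KontsevichZagierPeriods.KontsevichZagierPeriods.Cruxes.StokesGeneration.FibrewiseStokes

end
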